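import Summits.AnomalousDissipation.AnomalousDissipation.Theorems.SolenoidalFractalHomogenisationLagrangianStepSidebandSkewFrame
import Summits.AnomalousDissipation.AnomalousDissipation.Theorems.SolenoidalFractalHomogenisationLagrangianStepSidebandResponse
import HarnessLib

/-!
# K1L_D `LagrangianRenormalisationStepDesign` (stmt-AnomalousDissipation-27980), registered stub `stub_D1_V0thg` (v28, rulings D28-3 (3)/D28-6/D28-7), port-map layer L4:
# the TWISTED periodic linear response of the frozen-frame truncated `ξ = 0` sideband system EXISTS, so `responseθ` / `meanFeedbackθ` / `psiStarθ` are the intended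
# objects (helper; `--kind proof --supports stmt-AnomalousDissipation-27980 --as helper`)

Summits-side helper file of route `SolenoidalFractalHomogenisation` (prover seat `ad-k1l-cellLawV-w1` g9; road of record D28-7 = port map §3 L4).  Everything proved; no
definitions, no named facts, no sorry.  The frozen-frame twin of `…SidebandResponse` (brick T2, existence part) for the objects of `…SidebandDefsFrame`; the time
lemmas `continuous_slotEnvelope`, `slotEnvelope_add_period`, `linkCoeff_add_period` of the flat file are REUSED BY NAME.
* §1 `sourceCompθ_add_period`, `sourceθ_add_period`, `genCompθ_add_period`, `genθ_add_period`, `continuous_sourceθ`, `continuous_genθ`;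
* §2 **`exists_isPeriodicResponseθ`** — for `NearIso 𝔸 lo' hi'` (`lo' > 0`, 𝔸 undeformed), a frame with `c|k|² ≤ |G₀ᵀk|²` (`c > 0`) and `γ₁ > 0`, every truncation `R`
  and slot `j` admit a twisted periodic response: G7 `…CellLawVSlowGraphLinearResponse.linearGraph_periodic_on` with `A₂₂ = genθ` (dissipative with rate
  `min(γ₁, 4π² lo' c)` by `real_inner_genθ_le`), `A₂₁ = ε • sourceθⱼ`, rescaled;
* §3 `isPeriodicResponseθ_responseθ_of_nearIso`, `isPeriodicResponseθ_responseθ_psiStarθ`.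
NOT a proof of `stub_D1_V0thg`, of K1L_D, or of anomalous dissipation; rung F-D1.A0 infrastructure.
-/

set_option linter.dupNamespace false

noncomputable section

namespace Summit.AnomalousDissipation.AnomalousDissipation.Theorems.SolenoidalFractalHomogenisation.LagrangianStep.Sideband

open Set MeasureTheory Complex UnitAddTorus Filter Topology
open scoped InnerProductSpace
open Literature.Analysis Literature.Analysis.FunctionSpaces Literature.Analysis.FunctionSpaces.Torus
open Literature.Analysis.FluidPDE Literature.Analysis.FluidPDE.Torus Literature.Analysis.FluidPDE.LatticeShear
open Summit.AnomalousDissipation.AnomalousDissipation.Theorems.SolenoidalFractalHomogenisation.LagrangianStep.CellChain (linkCoeff linkCoeff_def continuous_linkCoeff)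
open Summit.AnomalousDissipation.AnomalousDissipation.Theorems.SolenoidalFractalHomogenisation.PermissibleCarrier (period_pos continuous_trapezoid_fract)

variable {k₀ : ℕ}

/-! ## §1 Time dependence of the twisted coefficients: continuity and periodicity -/

/-- The unit source components are `P`-periodic. [cite: MajdaKramer1999, §2.2.1.3] -/
theorem sourceCompθ_add_period (W₁ : LatticeWord k₀) (G₀ : Matrix (Fin 3) (Fin 3) ℝ) (R : ℕ) (j : Fin k₀) (t : ℝ) (z : box R) :
    sourceCompθ W₁ G₀ R j (t + W₁.period) z = sourceCompθ W₁ G₀ R j t z := by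
  rw [sourceCompθ, sourceCompθ, slotEnvelope_add_period]

/-- The unit source is `P`-periodic. [cite: MajdaKramer1999, §2.2.1.3] -/
theorem sourceθ_add_period (W₁ : LatticeWord k₀) (G₀ : Matrix (Fin 3) (Fin 3) ℝ) (R : ℕ) (j : Fin k₀) (t : ℝ) : sourceθ W₁ G₀ R j (t + W₁.period) = sourceθ W₁ G₀ R j t := by
  unfold sourceθ
  congr 2
  funext z
  exact sourceCompθ_add_period W₁ G₀ R j t z

/-- The generator components are `P`-periodic. [cite: MajdaKramer1999, §2.2.1.3] -/
theorem genCompθ_add_period (W₁ : LatticeWord k₀) (𝔸 : Torus.Visc4 (Fin 3)) (G₀ : Matrix (Fin 3) (Fin 3) ℝ) (γ₁ : ℝ) (R : ℕ) (t : ℝ) (z : box R) :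
    genCompθ W₁ 𝔸 G₀ γ₁ R (t + W₁.period) z = genCompθ W₁ 𝔸 G₀ γ₁ R t z := by
  rw [genCompθ, genCompθ]
  congr 1
  exact Finset.sum_congr rfl fun j _ => by rw [linkCoeff_add_period]

/-- The generator is `P`-periodic. [cite: MajdaKramer1999, §2.2.1.3] -/
theorem genθ_add_period (W₁ : LatticeWord k₀) (𝔸 : Torus.Visc4 (Fin 3)) (G₀ : Matrix (Fin 3) (Fin 3) ℝ) (γ₁ : ℝ) (R : ℕ) (t : ℝ) :
    genθ W₁ 𝔸 G₀ γ₁ R (t + W₁.period) = genθ W₁ 𝔸 G₀ γ₁ R t := by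
  unfold genθ
  congr 2
  funext z
  exact genCompθ_add_period W₁ 𝔸 G₀ γ₁ R t z

/-- The unit source is continuous in time (operator norm). [cite: MajdaKramer1999, §2.2.1.3] -/
theorem continuous_sourceθ (W₁ : LatticeWord k₀) (G₀ : Matrix (Fin 3) (Fin 3) ℝ) (R : ℕ) (j : Fin k₀) : Continuous fun t => sourceθ W₁ G₀ R j t := by
  rw [continuous_clm_apply]
  intro v
  have hc : Continuous fun t => (PiLp.continuousLinearEquiv 2 ℂ (fun _ : box R => EuclideanSpace ℂ (Fin 3))).symm
      (fun z : box R => sourceCompθ W₁ G₀ R j t z v) := by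
    refine (PiLp.continuousLinearEquiv 2 ℂ (fun _ : box R => EuclideanSpace ℂ (Fin 3))).symm.continuous.comp ?_
    refine continuous_pi fun z => ?_
    have he := (Complex.continuous_ofReal.comp (continuous_slotEnvelope W₁ j))
    simp only [sourceCompθ]
    refine Continuous.add ?_ ?_
    · split_ifs
      · exact ((((continuous_const.mul he).mul continuous_const).neg).smul continuous_const)
      · exact continuous_const
    · split_ifs
      · exact ((((continuous_const.mul he).mul continuous_const).neg).smul continuous_const)
      · exact continuous_const
  refine hc.congr fun t => ?_
  simp [sourceθ]

/-- The generator is continuous in time (operator norm). [cite: MajdaKramer1999, §2.2.1.3] -/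
theorem continuous_genθ (W₁ : LatticeWord k₀) (𝔸 : Torus.Visc4 (Fin 3)) (G₀ : Matrix (Fin 3) (Fin 3) ℝ) (γ₁ : ℝ) (R : ℕ) : Continuous fun t => genθ W₁ 𝔸 G₀ γ₁ R t := by
  rw [continuous_clm_apply]
  intro y
  have hc : Continuous fun t => (PiLp.continuousLinearEquiv 2 ℂ (fun _ : box R => EuclideanSpace ℂ (Fin 3))).symm
      (fun z : box R => genCompθ W₁ 𝔸 G₀ γ₁ R t z y) := by
    refine (PiLp.continuousLinearEquiv 2 ℂ (fun _ : box R => EuclideanSpace ℂ (Fin 3))).symm.continuous.comp ?_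
    refine continuous_pi fun z => ?_
    have h : (fun t => genCompθ W₁ 𝔸 G₀ γ₁ R t z y) = fun t =>
        -((((4 * Real.pi ^ 2 : ℝ) : ℂ)) • transversalProjR (twistFreq G₀ z.1) (Torus.symbT (Torus.majorTranspose (Torus.Visc4.conj G₀ 𝔸)) z.1 (transversalProjR (twistFreq G₀ z.1) (coordL R z.1 y)))) -
        ((γ₁ : ℝ) : ℂ) • (coordL R z.1 y - transversalProjR (twistFreq G₀ z.1) (coordL R z.1 y)) -
        ∑ j, linkCoeff W₁ 1 z.1 j t • transversalProjR (twistFreq G₀ z.1)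
          (slotAmp W₁ j • transversalProjR (twistFreq G₀ (z.1 - (W₁.phase j).m)) (coordL R (z.1 - (W₁.phase j).m) y) +
            starRingEnd ℂ (slotAmp W₁ j) • transversalProjR (twistFreq G₀ (z.1 + (W₁.phase j).m)) (coordL R (z.1 + (W₁.phase j).m) y)) :=
      funext fun t => genCompθ_apply W₁ 𝔸 G₀ γ₁ R t z y
    rw [h]
    refine (continuous_const.sub ?_)
    exact continuous_finsetSum _ fun j _ => (continuous_linkCoeff W₁ 1 z.1 j).smul continuous_const
  refine hc.congr fun t => ?_
  simp [genθ]

/-! ## §2 Existence of the periodic linear response -/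

/-- **THE PERIODIC LINEAR RESPONSE EXISTS**: for `NearIso 𝔸 lo' hi'` with `lo' > 0` and a longitudinal damping `γ₁ > 0`, every truncation `R` and every
slot `j` admit a periodic response `N` (`IsPeriodicResponseθ W₁ 𝔸 G₀ γ₁ R j N`).  [cite: SandersVerhulstMurdock2007, Lemma 5.2.7 (linear case)]
[cite: MajdaKramer1999, §2.2.1.3 (cell problem (49))] -/
theorem exists_isPeriodicResponseθ (W₁ : LatticeWord k₀) {𝔸 : Torus.Visc4 (Fin 3)} {lo' hi' : ℝ} (h𝔸 : Torus.NearIso 𝔸 lo' hi') (hlo' : 0 < lo')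
    (G₀ : Matrix (Fin 3) (Fin 3) ℝ) {c : ℝ} (hc : 0 < c) (hG : ∀ k : Fin 3 → ℤ, c * freqNormSq k ≤ ∑ a, twistFreq G₀ k a ^ 2)
    {γ₁ : ℝ} (hγ₁ : 0 < γ₁) (R : ℕ) (j : Fin k₀) : ∃ N, IsPeriodicResponseθ W₁ 𝔸 G₀ γ₁ R j N := by
  have hP : 0 < W₁.period := period_pos W₁
  set γ : ℝ := min γ₁ (4 * Real.pi ^ 2 * (lo' * c)) with hγdef
  have hγ : 0 < γ := lt_min hγ₁ (by positivity)
  -- a bound for the source on the period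
  obtain ⟨δ₀, hδ₀⟩ := (isCompact_Icc (a := (0:ℝ)) (b := W₁.period)).exists_bound_of_continuousOn (continuous_sourceθ W₁ G₀ R j).continuousOn
  set δ₁ : ℝ := max δ₀ 0 with hδ₁def
  have hδ₁ : 0 ≤ δ₁ := le_max_right _ _
  have hδ₀₁ : ∀ t ∈ Icc (0:ℝ) W₁.period, ‖sourceθ W₁ G₀ R j t‖ ≤ δ₁ := fun t ht => (hδ₀ t ht).trans (le_max_left _ _)
  -- the scaling
  set ε : ℝ := γ / (4 * (δ₁ + 1)) with hεdef
  have hε : 0 < ε := by positivity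
  set δ : ℝ := ε * δ₁ with hδdef
  have hδ : 0 ≤ δ := by positivity
  have hδγ : δ ≤ γ / 4 := by
    rw [hδdef, hεdef, div_mul_eq_mul_div, div_le_div_iff₀ (by positivity) (by norm_num)]
    nlinarith [hγ.le, hδ₁]
  have h8 : 8 * δ ^ 2 ≤ γ ^ 2 := by nlinarith [hδγ, hδ, hγ.le]
  -- G7
  obtain ⟨Nε, hcN, hd, -, hp⟩ := SlowGraph.linearGraph_periodic_on (EuclideanSpace ℂ (Fin 3)) (Space R)
    (fun t => ε • (sourceθ W₁ G₀ R j t).restrictScalars ℝ) (fun t => (genθ W₁ 𝔸 G₀ γ₁ R t).restrictScalars ℝ) γ δ W₁.period W₁.period hδ hγ h8 hP le_rfl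
    (fun t _ z => by
      rw [ContinuousLinearMap.coe_restrictScalars']
      exact real_inner_genθ_le W₁ h𝔸 hlo'.le G₀ hc.le hG γ₁ R t z)
    (fun t ht => by
      rw [norm_smul, Real.norm_of_nonneg hε.le, ContinuousLinearMap.norm_restrictScalars]
      exact mul_le_mul_of_nonneg_left (hδ₀₁ t ht) hε.le)
    (by
      rw [continuousOn_clm_apply]
      intro v
      have h := ((continuous_clm_apply.1 (continuous_sourceθ W₁ G₀ R j)) v).const_smul ε
      exact h.continuousOn.congr fun t _ => by simp)
    (by
      rw [continuousOn_clm_apply]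
      intro v
      have h := (continuous_clm_apply.1 (continuous_genθ W₁ 𝔸 G₀ γ₁ R)) v
      exact h.continuousOn.congr fun t _ => by simp)
    (fun t _ _ => by rw [sourceθ_add_period])
    (fun t _ _ => by rw [genθ_add_period])
  -- rescale
  have hper : Nε W₁.period = Nε 0 := by
    have h := hp 0 le_rfl (by rw [zero_add])
    rwa [zero_add] at h
  refine ⟨fun t => ε⁻¹ • Nε t, hcN.const_smul ε⁻¹, fun t ht => ?_, by simp only [hper]⟩
  have h := (hd t ht).const_smul ε⁻¹
  refine h.congr_deriv ?_
  rw [smul_add, smul_smul, inv_mul_cancel₀ hε.ne', one_smul, ContinuousLinearMap.comp_smul]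

/-! ## §3 `Sideband.response` is a periodic response -/

/-- Under the hypotheses of `exists_isPeriodicResponse`, the chosen `Sideband.response` is a periodic response. [cite: SandersVerhulstMurdock2007, Lemma 5.2.7 (linear case)] -/
theorem isPeriodicResponseθ_responseθ_of_nearIso (W₁ : LatticeWord k₀) {𝔸 : Torus.Visc4 (Fin 3)} {lo' hi' : ℝ} (h𝔸 : Torus.NearIso 𝔸 lo' hi')
    (hlo' : 0 < lo') (G₀ : Matrix (Fin 3) (Fin 3) ℝ) {c : ℝ} (hc : 0 < c) (hG : ∀ k : Fin 3 → ℤ, c * freqNormSq k ≤ ∑ a, twistFreq G₀ k a ^ 2)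
    {γ₁ : ℝ} (hγ₁ : 0 < γ₁) (R : ℕ) (j : Fin k₀) :
    IsPeriodicResponseθ W₁ 𝔸 G₀ γ₁ R j (responseθ W₁ 𝔸 G₀ γ₁ R j) :=
  isPeriodicResponseθ_responseθ (exists_isPeriodicResponseθ W₁ h𝔸 hlo' G₀ hc hG hγ₁ R j)

/-- **The data of `psiStarθ` admit the twisted periodic response**: for `ν > 0`, a background shape `S` in a window `NearIso S lo hi` with `lo > 0` and a frame with
`c|k|² ≤ |G₀ᵀk|²` (`c > 0`), the response used in `psiStarθ W M hM ν S G₀` (`W₁ = (W.stretch M).stretch (1/ν)`, `𝔸 = ν•S`, `γ₁ = 1`, `R = R0 ν`) is a periodic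
response for every slot. [cite: SandersVerhulstMurdock2007, Lemma 5.2.7 (linear case)] [cite: MajdaKramer1999, §2.2.1.3] -/
theorem isPeriodicResponseθ_responseθ_psiStarθ (W : LatticeWord k₀) (M : ℝ) (hM : 0 < M) {ν : ℝ} (hν : 0 < ν) {S : Torus.Visc4 (Fin 3)}
    {lo hi : ℝ} (hS : Torus.NearIso S lo hi) (hlo : 0 < lo) (G₀ : Matrix (Fin 3) (Fin 3) ℝ) {c : ℝ} (hc : 0 < c)
    (hG : ∀ k : Fin 3 → ℤ, c * freqNormSq k ≤ ∑ a, twistFreq G₀ k a ^ 2) (j : Fin k₀) :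
    IsPeriodicResponseθ ((W.stretch M hM).stretch (1 / ν) (one_div_pos.mpr hν)) (ν • S) G₀ 1 (R0 ν) j
      (responseθ ((W.stretch M hM).stretch (1 / ν) (one_div_pos.mpr hν)) (ν • S) G₀ 1 (R0 ν) j) :=
  isPeriodicResponseθ_responseθ_of_nearIso _ (hS.smul hν.le) (mul_pos hν hlo) G₀ hc hG one_pos _ j

end Summit.AnomalousDissipation.AnomalousDissipation.Theorems.SolenoidalFractalHomogenisation.LagrangianStep.Sideband

end
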